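import Summits.QuantumFields.YangMills.Theses.EntropyBudgetEquipartition
import Summits.QuantumFields.YangMills.Theorems.SourcedPressureJensenJensenFloor
import HarnessLib

/-!
# Route `EntropyBudgetEquipartition`, crux `EntropyBudgetTransfer` (stmt-QuantumFields-22401) — modular one-sided laws with an explicit Gaussian constant

HONEST LABEL: helper lemmas toward a RECORD-label rung (R2ξ-G, `WeakCouplingRates.XiPow`, an UPPER bound on the lattice gap);
nothing here bears on the Clay Yang–Mills mass gap, which is NOT proved by any of this.

`TwoSignedSource.twoSidedLaw_of_twoSignedSource` takes the sourced pressure bound for both signs of `h` in ONE binder.  A prover of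
the sibling crux `SourcedPressureIncrement` (LINE 2, `h > 0` only) and a future prover of its negative-`h` mirror will produce two
SEPARATE statements, with different constants but — necessarily, for a two-sided law — the same Gaussian constant `σ`.  This file
is the modular bookkeeping, pointwise in `(G, r)` and with every constant explicit so that the pieces compose:

* `lowerLaw_of_posSource` — the `h > 0` bound `|Λ|⁻¹ log E e^{−hH} ≤ −hσC(n)² + Cβ^(−κ) + Mh²` (`0 < h ≤ h₀`, `β ≥ β₀`, `1 ≤ n ≤ 2β^A`,
  eventually in `L`) gives `σC(n)² − (|C|+|M|) β^(−κ/2) ≤ β² Cov` for `β ≥ max β₀ (max 1 (h₀^(−2/κ)))` (this is `JensenFloor_of` with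
  `σ` kept visible);
* `upperLaw_of_negSource` — the mirrored bound `|Λ|⁻¹ log E e^{+hH} ≤ +hσC(n)² + Cβ^(−κ) + Mh²` gives
  `β² Cov ≤ σC(n)² + (|C|+|M|) β^(−κ/2)`;
* `twoSidedLaw_of_lower_upper` — a lower law `(κ₁, A₁, C₁, β₁)` and an upper law `(κ₂, A₂, C₂, β₂)` with the same `σ > 0` give the
  two-sided law of the crux with `κ = min κ₁ κ₂`, `A = min A₁ A₂`, `C = max C₁ 0 + max C₂ 0`, `β₀ = max 1 (max β₁ β₂)`;
* `entropyBudgetTransfer_of_lower_upper` — hence the crux from the two one-sided laws at every `(G, r)`.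

Tools: Jensen on the torus `stub_jensen` (every real `h`) and the centring identity `stub_centredSum` of the landed `JensenFloor` stubs.
[folklore]
-/

noncomputable section

namespace Summit.QuantumFields.YangMills.Theorems.EntropyBudgetEquipartition.OneSidedLaws

open MeasureTheory Filter
open Literature.MathematicalPhysics.QuantumFieldTheory Literature.MathematicalPhysics.QuantumLattice
  Summit.QuantumFields.YangMills.Theorems.WeakCouplingRates
  Summit.QuantumFields.YangMills.Cruxes.JensenFloor.Birth

/-! ### Real arithmetic cores -/

/-- Lower core: Jensen `−ηE ≤ P`, the bound `V·P ≤ −ησS + Cε + Mη²` (`η² = ε`, `η > 0`, `V > 0`) and `V·E = β²X` give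
`σS − (|C|+|M|)η ≤ β²X`. [folklore] -/
theorem lower_core {V E P X S σ C M η ε β : ℝ} (hV : 0 < V) (hη : 0 < η) (hsq : η * η = ε)
    (j : -η * E ≤ P) (hb : V * P ≤ -η * (σ * S) + C * ε + M * η ^ 2) (c : V * E = β ^ 2 * X) :
    σ * S - (|C| + |M|) * η ≤ β ^ 2 * X := by
  have j' : V * (-η * E) ≤ V * P := mul_le_mul_of_nonneg_left j hV.le
  have e1 : V * (-η * E) = -η * (β ^ 2 * X) := by rw [← c]; ring
  rw [← hsq] at hb
  have low1 : η * (σ * S - (C + M) * η) ≤ η * (β ^ 2 * X) := by nlinarith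
  have low : σ * S - (C + M) * η ≤ β ^ 2 * X := le_of_mul_le_mul_left low1 hη
  have hCM : (C + M) * η ≤ (|C| + |M|) * η := by
    apply mul_le_mul_of_nonneg_right _ hη.le
    linarith [le_abs_self C, le_abs_self M]
  linarith

/-- Upper core: Jensen `ηE ≤ P`, the bound `V·P ≤ ησS + Cε + Mη²` (`η² = ε`, `η > 0`, `V > 0`) and `V·E = β²X` give
`β²X ≤ σS + (|C|+|M|)η`. [folklore] -/
theorem upper_core {V E P X S σ C M η ε β : ℝ} (hV : 0 < V) (hη : 0 < η) (hsq : η * η = ε)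
    (j : η * E ≤ P) (hb : V * P ≤ η * (σ * S) + C * ε + M * η ^ 2) (c : V * E = β ^ 2 * X) :
    β ^ 2 * X ≤ σ * S + (|C| + |M|) * η := by
  have j' : V * (η * E) ≤ V * P := mul_le_mul_of_nonneg_left j hV.le
  have e1 : V * (η * E) = η * (β ^ 2 * X) := by rw [← c]; ring
  rw [← hsq] at hb
  have up1 : η * (β ^ 2 * X) ≤ η * (σ * S + (C + M) * η) := by nlinarith
  have up : β ^ 2 * X ≤ σ * S + (C + M) * η := le_of_mul_le_mul_left up1 hη
  have hCM : (C + M) * η ≤ (|C| + |M|) * η := by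
    apply mul_le_mul_of_nonneg_right _ hη.le
    linarith [le_abs_self C, le_abs_self M]
  linarith

/-! ### One-sided laws at one `(G, r)`, constants explicit -/

section OneSided

variable (G : Type) [Group G] [TopologicalSpace G] [IsTopologicalGroup G] [CompactSpace G]
  [MeasurableSpace G] [BorelSpace G] (r : LatticeRep G)

/-- **Lower law from the positive-`h` sourced pressure bound, `σ` explicit** (pointwise in `(G, r)`; this is `JensenFloor_of` with
the Gaussian constant kept visible so that it composes with an upper law). [folklore] -/
theorem lowerLaw_of_posSource {κ A M C σ h₀ β₀ : ℝ} (hκ : 0 < κ) (hh₀ : 0 < h₀)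
    (hKS : ∀ β : ℝ, β₀ ≤ β → ∀ n : ℕ, 1 ≤ n → (n : ℝ) ≤ 2 * β ^ A → ∀ h : ℝ, 0 < h → h ≤ h₀ → ∀ᶠ L : ℕ in Filter.atTop,
        ((L + 1 : ℝ) ^ 4)⁻¹ * Real.log (wilsonExpectation (L := L + 1) r.ρ β fun U => Real.exp (-h * ∑ x : Fin 4 → Fin (L + 1),
          toTorusObservable (L + 1) (fun V => (β * plaqCost0 (d := 4) r.ρ 1 2 (configShift (fun i => -((x i : ℕ) : ℤ)) V) -
            β * wilsonExpectation (L := L + 1) r.ρ β (toTorusObservable (L + 1) (plaqCost0 (d := 4) r.ρ 1 2))) *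
            (β * plaqCost0 (d := 4) r.ρ 1 2 (timeShiftLG (G := G) n (configShift (fun i => -((x i : ℕ) : ℤ)) V)) -
              β * wilsonExpectation (L := L + 1) r.ρ β (toTorusObservable (L + 1) (plaqCost0 (d := 4) r.ρ 1 2)))) U)) ≤
          -h * (σ * (curvaturePlaquetteCorr (d := 4) (by norm_num) (n : ℤ)) ^ 2) + C * β ^ (-κ) + M * h ^ 2) :
    ∀ β : ℝ, max β₀ (max 1 (h₀ ^ (-(2 / κ)))) ≤ β → ∀ n : ℕ, 1 ≤ n → (n : ℝ) ≤ 2 * β ^ A →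
      ∀ᶠ L : ℕ in Filter.atTop, σ * (curvaturePlaquetteCorr (d := 4) (by norm_num) (n : ℤ)) ^ 2 - (|C| + |M|) * β ^ (-(κ / 2)) ≤
        β ^ 2 * (wilsonExpectation (L := L + 1) r.ρ β (toTorusObservable (L + 1) fun U =>
            plaqCost0 (d := 4) r.ρ 1 2 U * plaqCost0 (d := 4) r.ρ 1 2 (timeShiftLG (G := G) n U)) -
          wilsonExpectation (L := L + 1) r.ρ β (toTorusObservable (L + 1) (plaqCost0 (d := 4) r.ρ 1 2)) *
            wilsonExpectation (L := L + 1) r.ρ β (toTorusObservable (L + 1) fun U =>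
              plaqCost0 (d := 4) r.ρ 1 2 (timeShiftLG (G := G) n U))) := by
  intro β hβ n hn1 hn2
  have hβ₀ : β₀ ≤ β := le_trans (le_max_left _ _) hβ
  have hβ1 : (1 : ℝ) ≤ β := le_trans (le_trans (le_max_left _ _) (le_max_right _ _)) hβ
  have hβB : h₀ ^ (-(2 / κ)) ≤ β := le_trans (le_trans (le_max_right _ _) (le_max_right _ _)) hβ
  have hβpos : 0 < β := by linarith
  have hpos : 0 < β ^ (-(κ / 2)) := Real.rpow_pos_of_pos hβpos _
  have hle : β ^ (-(κ / 2)) ≤ h₀ := rpow_half_le hκ hh₀ hβB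
  have hsq : β ^ (-(κ / 2)) * β ^ (-(κ / 2)) = β ^ (-κ) := rpow_half_mul_half hβpos
  filter_upwards [hKS β hβ₀ n hn1 hn2 (β ^ (-(κ / 2))) hpos hle] with L hL
  have j := stub_jensen G r β n (β ^ (-(κ / 2))) L
  have c := stub_centredSum G r β n L
  have hV : (0 : ℝ) < ((L + 1 : ℝ) ^ 4)⁻¹ := by positivity
  exact lower_core hV hpos hsq j hL c

/-- **Upper law from the negative-`h` sourced pressure bound, `σ` explicit** (pointwise in `(G, r)`): if for `β ≥ β₀`,
`1 ≤ n ≤ 2β^A`, `0 < h ≤ h₀`, eventually in `L`, `|Λ|⁻¹ log E_{β,Λ} exp(+h H_{n,Λ}) ≤ h σ C(n)² + C β^(−κ) + M h²`, then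
`β² Cov_{β,Λ}(c₀, c_{n e₀}) ≤ σ C(n)² + (|C| + |M|) β^(−κ/2)` for `β ≥ max β₀ (max 1 (h₀^(−2/κ)))` — Jensen at `−h` (`stub_jensen`)
and `stub_centredSum`. [folklore] -/
theorem upperLaw_of_negSource {κ A M C σ h₀ β₀ : ℝ} (hκ : 0 < κ) (hh₀ : 0 < h₀)
    (hKS : ∀ β : ℝ, β₀ ≤ β → ∀ n : ℕ, 1 ≤ n → (n : ℝ) ≤ 2 * β ^ A → ∀ h : ℝ, 0 < h → h ≤ h₀ → ∀ᶠ L : ℕ in Filter.atTop,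
        ((L + 1 : ℝ) ^ 4)⁻¹ * Real.log (wilsonExpectation (L := L + 1) r.ρ β fun U => Real.exp (h * ∑ x : Fin 4 → Fin (L + 1),
          toTorusObservable (L + 1) (fun V => (β * plaqCost0 (d := 4) r.ρ 1 2 (configShift (fun i => -((x i : ℕ) : ℤ)) V) -
            β * wilsonExpectation (L := L + 1) r.ρ β (toTorusObservable (L + 1) (plaqCost0 (d := 4) r.ρ 1 2))) *
            (β * plaqCost0 (d := 4) r.ρ 1 2 (timeShiftLG (G := G) n (configShift (fun i => -((x i : ℕ) : ℤ)) V)) -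
              β * wilsonExpectation (L := L + 1) r.ρ β (toTorusObservable (L + 1) (plaqCost0 (d := 4) r.ρ 1 2)))) U)) ≤
          h * (σ * (curvaturePlaquetteCorr (d := 4) (by norm_num) (n : ℤ)) ^ 2) + C * β ^ (-κ) + M * h ^ 2) :
    ∀ β : ℝ, max β₀ (max 1 (h₀ ^ (-(2 / κ)))) ≤ β → ∀ n : ℕ, 1 ≤ n → (n : ℝ) ≤ 2 * β ^ A →
      ∀ᶠ L : ℕ in Filter.atTop,
        β ^ 2 * (wilsonExpectation (L := L + 1) r.ρ β (toTorusObservable (L + 1) fun U =>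
            plaqCost0 (d := 4) r.ρ 1 2 U * plaqCost0 (d := 4) r.ρ 1 2 (timeShiftLG (G := G) n U)) -
          wilsonExpectation (L := L + 1) r.ρ β (toTorusObservable (L + 1) (plaqCost0 (d := 4) r.ρ 1 2)) *
            wilsonExpectation (L := L + 1) r.ρ β (toTorusObservable (L + 1) fun U =>
              plaqCost0 (d := 4) r.ρ 1 2 (timeShiftLG (G := G) n U))) ≤
        σ * (curvaturePlaquetteCorr (d := 4) (by norm_num) (n : ℤ)) ^ 2 + (|C| + |M|) * β ^ (-(κ / 2)) := by
  intro β hβ n hn1 hn2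
  have hβ₀ : β₀ ≤ β := le_trans (le_max_left _ _) hβ
  have hβ1 : (1 : ℝ) ≤ β := le_trans (le_trans (le_max_left _ _) (le_max_right _ _)) hβ
  have hβB : h₀ ^ (-(2 / κ)) ≤ β := le_trans (le_trans (le_max_right _ _) (le_max_right _ _)) hβ
  have hβpos : 0 < β := by linarith
  have hpos : 0 < β ^ (-(κ / 2)) := Real.rpow_pos_of_pos hβpos _
  have hle : β ^ (-(κ / 2)) ≤ h₀ := rpow_half_le hκ hh₀ hβB
  have hsq : β ^ (-(κ / 2)) * β ^ (-(κ / 2)) = β ^ (-κ) := rpow_half_mul_half hβpos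
  filter_upwards [hKS β hβ₀ n hn1 hn2 (β ^ (-(κ / 2))) hpos hle] with L hL
  have j := stub_jensen G r β n (-(β ^ (-(κ / 2)))) L
  have c := stub_centredSum G r β n L
  have hV : (0 : ℝ) < ((L + 1 : ℝ) ^ 4)⁻¹ := by positivity
  simp only [neg_neg] at j
  exact upper_core hV hpos hsq j hL c

/-- **Two-sided law from a lower and an upper law with the same `σ`** (pointwise in `(G, r)`): constants
`κ = min κ₁ κ₂`, `A = min A₁ A₂`, `C = max C₁ 0 + max C₂ 0`, `β₀ = max 1 (max β₁ β₂)`. [folklore] -/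
theorem twoSidedLaw_of_lower_upper {σ κ₁ A₁ C₁ β₁ κ₂ A₂ C₂ β₂ : ℝ} (hσ : 0 < σ) (hκ₁ : 0 < κ₁) (hA₁ : 0 < A₁)
    (hκ₂ : 0 < κ₂) (hA₂ : 0 < A₂)
    (hlow : ∀ β : ℝ, β₁ ≤ β → ∀ n : ℕ, 1 ≤ n → (n : ℝ) ≤ 2 * β ^ A₁ →
      ∀ᶠ L : ℕ in Filter.atTop, σ * (curvaturePlaquetteCorr (d := 4) (by norm_num) (n : ℤ)) ^ 2 - C₁ * β ^ (-κ₁) ≤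
        β ^ 2 * (wilsonExpectation (L := L + 1) r.ρ β (toTorusObservable (L + 1) fun U =>
            plaqCost0 (d := 4) r.ρ 1 2 U * plaqCost0 (d := 4) r.ρ 1 2 (timeShiftLG (G := G) n U)) -
          wilsonExpectation (L := L + 1) r.ρ β (toTorusObservable (L + 1) (plaqCost0 (d := 4) r.ρ 1 2)) *
            wilsonExpectation (L := L + 1) r.ρ β (toTorusObservable (L + 1) fun U =>
              plaqCost0 (d := 4) r.ρ 1 2 (timeShiftLG (G := G) n U))))
    (hup : ∀ β : ℝ, β₂ ≤ β → ∀ n : ℕ, 1 ≤ n → (n : ℝ) ≤ 2 * β ^ A₂ →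
      ∀ᶠ L : ℕ in Filter.atTop,
        β ^ 2 * (wilsonExpectation (L := L + 1) r.ρ β (toTorusObservable (L + 1) fun U =>
            plaqCost0 (d := 4) r.ρ 1 2 U * plaqCost0 (d := 4) r.ρ 1 2 (timeShiftLG (G := G) n U)) -
          wilsonExpectation (L := L + 1) r.ρ β (toTorusObservable (L + 1) (plaqCost0 (d := 4) r.ρ 1 2)) *
            wilsonExpectation (L := L + 1) r.ρ β (toTorusObservable (L + 1) fun U =>
              plaqCost0 (d := 4) r.ρ 1 2 (timeShiftLG (G := G) n U))) ≤
        σ * (curvaturePlaquetteCorr (d := 4) (by norm_num) (n : ℤ)) ^ 2 + C₂ * β ^ (-κ₂)) :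
    ∃ κ A C σ β₀ : ℝ, 0 < κ ∧ 0 < A ∧ 0 < σ ∧ ∀ β : ℝ, β₀ ≤ β → ∀ n : ℕ, 1 ≤ n → (n : ℝ) ≤ 2 * β ^ A →
      ∀ᶠ L : ℕ in Filter.atTop, |β ^ 2 * (wilsonExpectation (L := L + 1) r.ρ β (toTorusObservable (L + 1) fun U =>
          plaqCost0 (d := 4) r.ρ 1 2 U * plaqCost0 (d := 4) r.ρ 1 2 (timeShiftLG (G := G) n U)) -
        wilsonExpectation (L := L + 1) r.ρ β (toTorusObservable (L + 1) (plaqCost0 (d := 4) r.ρ 1 2)) *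
          wilsonExpectation (L := L + 1) r.ρ β (toTorusObservable (L + 1) fun U =>
            plaqCost0 (d := 4) r.ρ 1 2 (timeShiftLG (G := G) n U))) -
        σ * (curvaturePlaquetteCorr (d := 4) (by norm_num) (n : ℤ)) ^ 2| ≤ C * β ^ (-κ) := by
  refine ⟨min κ₁ κ₂, min A₁ A₂, max C₁ 0 + max C₂ 0, σ, max 1 (max β₁ β₂), lt_min hκ₁ hκ₂, lt_min hA₁ hA₂, hσ, ?_⟩
  intro β hβ n hn1 hn2
  have hβ1 : (1 : ℝ) ≤ β := (le_max_left _ _).trans hβ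
  have hb₁ : β₁ ≤ β := ((le_max_left _ _).trans (le_max_right _ _)).trans hβ
  have hb₂ : β₂ ≤ β := ((le_max_right _ _).trans (le_max_right _ _)).trans hβ
  have hβpos : 0 < β := by linarith
  -- the window `n ≤ 2 β^{min A₁ A₂}` lies inside both windows
  have hw₁ : (n : ℝ) ≤ 2 * β ^ A₁ :=
    hn2.trans (mul_le_mul_of_nonneg_left (Real.rpow_le_rpow_of_exponent_le hβ1 (min_le_left _ _)) (by norm_num))
  have hw₂ : (n : ℝ) ≤ 2 * β ^ A₂ :=
    hn2.trans (mul_le_mul_of_nonneg_left (Real.rpow_le_rpow_of_exponent_le hβ1 (min_le_right _ _)) (by norm_num))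
  filter_upwards [hlow β hb₁ n hn1 hw₁, hup β hb₂ n hn1 hw₂] with L hL hU
  -- the two error terms are below `(max C₁ 0 + max C₂ 0) β^{-min κ₁ κ₂}`
  have hp : 0 ≤ β ^ (-min κ₁ κ₂) := Real.rpow_nonneg hβpos.le _
  have e₁ : C₁ * β ^ (-κ₁) ≤ max C₁ 0 * β ^ (-min κ₁ κ₂) :=
    (mul_le_mul_of_nonneg_right (le_max_left _ _) (Real.rpow_nonneg hβpos.le _)).trans
      (mul_le_mul_of_nonneg_left (Real.rpow_le_rpow_of_exponent_le hβ1 (by simp)) (le_max_right _ _))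
  have e₂ : C₂ * β ^ (-κ₂) ≤ max C₂ 0 * β ^ (-min κ₁ κ₂) :=
    (mul_le_mul_of_nonneg_right (le_max_left _ _) (Real.rpow_nonneg hβpos.le _)).trans
      (mul_le_mul_of_nonneg_left (Real.rpow_le_rpow_of_exponent_le hβ1 (by simp)) (le_max_right _ _))
  rw [abs_le]
  constructor <;> nlinarith [e₁, e₂, hL, hU, hp, le_max_right C₁ 0, le_max_right C₂ 0]

end OneSided

/-- **`EntropyBudgetTransfer` from a lower and an upper law with a common `σ` at every `(G, r)`.**  A reduction of a
RECORD-label rung crux; NOT the Clay mass gap. [folklore] -/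
theorem entropyBudgetTransfer_of_lower_upper
    (h : ∀ (G : Type) [Group G] [TopologicalSpace G] [IsTopologicalGroup G] [CompactSpace G], IsCompactSimpleLieGroup G →
      letI : MeasurableSpace G := borel G; haveI : BorelSpace G := ⟨rfl⟩; ∀ r : LatticeRep G,
      ∃ σ κ₁ A₁ C₁ β₁ κ₂ A₂ C₂ β₂ : ℝ, 0 < σ ∧ 0 < κ₁ ∧ 0 < A₁ ∧ 0 < κ₂ ∧ 0 < A₂ ∧
      (∀ β : ℝ, β₁ ≤ β → ∀ n : ℕ, 1 ≤ n → (n : ℝ) ≤ 2 * β ^ A₁ →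
        ∀ᶠ L : ℕ in Filter.atTop, σ * (curvaturePlaquetteCorr (d := 4) (by norm_num) (n : ℤ)) ^ 2 - C₁ * β ^ (-κ₁) ≤
          β ^ 2 * (wilsonExpectation (L := L + 1) r.ρ β (toTorusObservable (L + 1) fun U =>
              plaqCost0 (d := 4) r.ρ 1 2 U * plaqCost0 (d := 4) r.ρ 1 2 (timeShiftLG (G := G) n U)) -
            wilsonExpectation (L := L + 1) r.ρ β (toTorusObservable (L + 1) (plaqCost0 (d := 4) r.ρ 1 2)) *
              wilsonExpectation (L := L + 1) r.ρ β (toTorusObservable (L + 1) fun U =>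
                plaqCost0 (d := 4) r.ρ 1 2 (timeShiftLG (G := G) n U)))) ∧
      (∀ β : ℝ, β₂ ≤ β → ∀ n : ℕ, 1 ≤ n → (n : ℝ) ≤ 2 * β ^ A₂ →
        ∀ᶠ L : ℕ in Filter.atTop,
          β ^ 2 * (wilsonExpectation (L := L + 1) r.ρ β (toTorusObservable (L + 1) fun U =>
              plaqCost0 (d := 4) r.ρ 1 2 U * plaqCost0 (d := 4) r.ρ 1 2 (timeShiftLG (G := G) n U)) -
            wilsonExpectation (L := L + 1) r.ρ β (toTorusObservable (L + 1) (plaqCost0 (d := 4) r.ρ 1 2)) *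
              wilsonExpectation (L := L + 1) r.ρ β (toTorusObservable (L + 1) fun U =>
                plaqCost0 (d := 4) r.ρ 1 2 (timeShiftLG (G := G) n U))) ≤
          σ * (curvaturePlaquetteCorr (d := 4) (by norm_num) (n : ℤ)) ^ 2 + C₂ * β ^ (-κ₂))) :
    Summit.QuantumFields.YangMills.Theses.EntropyBudgetEquipartition.EntropyBudgetTransfer := by
  intro G _ _ _ _ hG
  letI : MeasurableSpace G := borel G
  haveI : BorelSpace G := ⟨rfl⟩
  intro r _
  obtain ⟨σ, κ₁, A₁, C₁, β₁, κ₂, A₂, C₂, β₂, hσ, hκ₁, hA₁, hκ₂, hA₂, hlow, hup⟩ := h G hG r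
  exact twoSidedLaw_of_lower_upper G r hσ hκ₁ hA₁ hκ₂ hA₂ hlow hup

end Summit.QuantumFields.YangMills.Theorems.EntropyBudgetEquipartition.OneSidedLaws

end
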